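import Literature.NumberTheory.EllipticCurves.RankinSelbergEulerProductHeckeRegroupProofs
import Literature.NumberTheory.QuadraticFields.QuadraticDedekindZetaKronecker
import HarnessLib

/-!
# Artin formalism for `f` over a quadratic field, LOCAL step: the Rankin–Selberg factors over
# `v ∣ p` against a character with `φ(ϖ_v) = θ(p)^{f_v}` multiply to the `p`-factors of
# `L(f ⊗ θ, s) · L(f ⊗ θκ, s)`

Topic `NumberTheory/EllipticCurves` (namespace `Literature.NumberTheory.EllipticCurves`; the
decomposition trichotomy is filed under `Literature.NumberTheory.QuadraticFields.Quadratic`).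
Everything here is PROVED (theorems only; no definitions, no named facts).

This is the LOCAL (algebraic) half of a discharge of the named fact
`Literature.NumberTheory.EllipticCurves.rankinSelbergEulerProductHecke_baseChangeDirichlet_eq`
(`RankinSelbergBaseChangeDirichlet.lean`, "Euler-factor bookkeeping (split / inert / ramified /
`ℓ ∣ m`)"), complementing the GLOBAL half `rankinSelbergEulerProductHecke_eq_mul_of_local`
(`RankinSelbergEulerProductHeckeRegroupProofs.lean`):

* `Quadratic.primesOver_trichotomy_of_kronecker` — the decomposition law of a quadratic field `K`
  (any discriminant) in the form the bookkeeping needs: for a prime `p` and a Dirichlet character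
  `κ` with the Kronecker values (`κ(p) = (d_K/p)` for odd `p`; `κ(2) = 1, −1, 0` as
  `d_K ≡ 1, 5 (mod 8)`, `2 ∣ d_K`), EITHER `κ(p) = 1` and there are two primes over `p`, both of
  norm `p`, OR `κ(p) = −1` and there is one, of norm `p²`, OR `κ(p) = 0` and there is one, of norm
  `p` (Cox, Prop. 5.16; extracted from the tree's proof of `finprod_primesOver_eq_of_kronecker`).
* `finprod_rankinSelbergLocalFactorInv_eq_of_heckeValue` — for `f ∈ S₂(Γ₀(N))`, ANY Hecke
  character `φ` of `K` whose extended-by-zero values at the places `v ∣ p` are `w^{f_v}` for one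
  complex number `w` (`f_v` the residue degree, `N(v) = p^{f_v}`), the finite product
  `∏_{v ∣ p} F_v(s)⁻¹` of the inverse Rankin–Selberg local factors
  (`rankinSelbergLocalFactorInvHecke`, `F_v = 1 − (α^{f}+β^{f}) w^{f} N(v)^{−s} + (αβ)^{f} w^{2f} N(v)^{−2s}`)
  equals `(1 − a_p w p^{−s} + e w² p^{−2s})⁻¹ (1 − a_p wκ(p) p^{−s} + e (wκ(p))² p^{−2s})⁻¹`,
  `e = p·𝟙_{p ∤ N}` — split: a square; inert: `α²+β² = a_p² − 2e` and
  `inert_localFactor_mul`; ramified: second factor `1`; and `w = 0` covers `p ∣ cond`.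
* `rankinSelbergEulerProductHecke_eq_mul_twist_of_heckeValue` — consequently, for a normalised
  eigenform `f`, a finite-order `φ` with `φ(ϖ_v) = θ(p)^{f_v}` (extended by zero) at every place,
  `θ` a Dirichlet character, and `re s > 2`:
  `rankinSelbergEulerProductHecke f φ s = twistedLSeries f θ s · twistedLSeries f (θ·κ) s`
  (`DirichletCharacter.mul`). For `φ = ψ_θ ∘ N_{K/ℚ}` this is the conclusion of
  `rankinSelbergEulerProductHecke_baseChangeDirichlet_eq`; what remains for its `_holds` is the
  class-field-theoretic evaluation `heckeValueExtZero (ψ_θ ∘ N) v = θ(p)^{f_v}` (`θ` primitive,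
  `(m, d_K) = 1`).

## References

* [Gross2004] B. H. Gross, *Heegner points and representation theory*, MSRI Publ. 49 (2004), §3
  (p. 40) and §13 (p. 49).
* [Cox2013] D. A. Cox, *Primes of the form x² + ny²*, 2nd ed. (2013), §5.B Prop. 5.16.
* [NeukirchANT1999] J. Neukirch, *Algebraic Number Theory* (1999), Ch. VII (10.4) (iv).
* [Nekovar1995] J. Nekovář, *On the p-adic height of Heegner cycles*, Math. Ann. 302 (1995),
  (0.5) and §3.4 (the local factors).
-/

noncomputable section

open scoped MatrixGroups ModularForm NumberTheorySymbols
open Module NumberField Polynomial Ideal UniqueFactorizationMonoid IsDedekindDomain CongruenceSubgroup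
open Literature.NumberTheory.GaloisRepresentations
open Literature.NumberTheory.EllipticCurves.ModularForms

/-! ### The decomposition trichotomy of a quadratic field, Kronecker-character form -/

namespace Literature.NumberTheory.QuadraticFields.Quadratic

variable {K : Type*} [Field K] [NumberField K]

/-- **Decomposition law of a quadratic field, any discriminant, as a trichotomy.** Let `[K : ℚ] = 2`
and let `κ` be a Dirichlet character with `κ(p) = (d_K / p)` for odd primes `p` and
`κ(2) = 1, −1, 0` according as `d_K ≡ 1, 5 (mod 8)` or `2 ∣ d_K`. For a prime `p`, exactly one of:
`κ(p) = 1`, two primes over `p`, each of norm `p` (split); `κ(p) = −1`, one prime over `p`, of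
norm `p²` (inert); `κ(p) = 0`, one prime over `p`, of norm `p` (ramified). (Dedekind–Kummer for
`ℤ[ω]`, `ω² = m + tω`, `d_K = t² + 4m`, exactly as in `finprod_primesOver_eq_of_kronecker`.)
[cite: Cox2013, §5.B Prop. 5.16 (PDF p. 119)] -/
theorem primesOver_trichotomy_of_kronecker (h2 : finrank ℚ K = 2) {M : ℕ}
    (κ : DirichletCharacter ℂ M)
    (hoddp : ∀ p : ℕ, p.Prime → p ≠ 2 → κ p = (J(NumberField.discr K | p) : ℂ))
    (htwo : κ 2 = if NumberField.discr K % 8 = 1 then 1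
      else if NumberField.discr K % 8 = 5 then -1 else 0)
    {p : ℕ} (hp : p.Prime) :
    (κ p = 1 ∧ (primesOver (span {(p : ℤ)}) (𝓞 K)).ncard = 2 ∧
        ∀ P ∈ primesOver (span {(p : ℤ)}) (𝓞 K), absNorm P = p) ∨
      (κ p = -1 ∧ (primesOver (span {(p : ℤ)}) (𝓞 K)).ncard = 1 ∧
        ∀ P ∈ primesOver (span {(p : ℤ)}) (𝓞 K), absNorm P = p ^ 2) ∨
      (κ p = 0 ∧ (primesOver (span {(p : ℤ)}) (𝓞 K)).ncard = 1 ∧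
        ∀ P ∈ primesOver (span {(p : ℤ)}) (𝓞 K), absNorm P = p) := by
  haveI := Fact.mk hp
  obtain ⟨b, hb⟩ := exists_basis_zero_eq_one h2
  have hD := discr_eq_sq_add_four_mul b hb
  set D := NumberField.discr K with hDdef
  generalize ht : b.repr (b 1 * b 1) 1 = t at hD
  generalize hm : b.repr (b 1 * b 1) 0 = m at hD
  -- the factors of `X² − tX − m (mod p)` control norms (`hnorm`) and the number of primes (`hcount`)
  have hnorm : ∀ {d : ℕ}, (∀ Q ∈ (normalizedFactors (X ^ 2 - C ((t : ℤ) : ZMod p) * X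
      - C ((m : ℤ) : ZMod p))).toFinset, Q.natDegree = d) →
      ∀ P ∈ primesOver (span {(p : ℤ)}) (𝓞 K), absNorm P = p ^ d := by
    intro d hd P hP
    refine absNorm_eq_pow_of_forall_natDegree_eq b hb ?_ hP
    rw [ht, hm]
    exact hd
  have hcount : (primesOver (span {(p : ℤ)}) (𝓞 K)).ncard = (normalizedFactors (X ^ 2
      - C ((t : ℤ) : ZMod p) * X - C ((m : ℤ) : ZMod p))).toFinset.card := by
    rw [ncard_primesOver_eq_card_toFinset b hb, ht, hm]
  rcases eq_or_ne p 2 with rfl | hp2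
  · -- `p = 2`
    have hκ2 : κ ((2 : ℕ) : ZMod M) = κ 2 := by rw [Nat.cast_ofNat]
    rw [hκ2, htwo]
    rcases Int.even_or_odd' t with ⟨k, rfl | rfl⟩
    · /- `t` even: `d_K = 4(k² + m)` is even, `2` ramifies: one prime of norm `2`, `κ(2) = 0` -/
      have h0 : (((2 * k : ℤ)) : ZMod 2) = 0 := by
        rw [Int.cast_mul, Int.cast_ofNat, show (2 : ZMod 2) = 0 from rfl, zero_mul]
      have hD8 : ¬ D % 8 = 1 ∧ ¬ D % 8 = 5 := by
        have e : D = 4 * (k ^ 2 + m) := by rw [hD]; ring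
        omega
      refine Or.inr (Or.inr ⟨by rw [if_neg hD8.1, if_neg hD8.2], ?_⟩)
      rw [h0] at hnorm hcount
      rcases Int.even_or_odd' m with ⟨j, rfl | rfl⟩
      · have hm0 : (((2 * j : ℤ)) : ZMod 2) = 0 := by
          rw [Int.cast_mul, Int.cast_ofNat, show (2 : ZMod 2) = 0 from rfl, zero_mul]
        rw [hm0] at hnorm hcount
        have hN := hnorm (d := 1) fun Q hQ => natDegree_eq_one_of_mem_zero_zero hQ
        rw [card_toFinset_normalizedFactors_X_sq_sub_zero_zero] at hcount
        exact ⟨hcount, fun P hP => by rw [hN P hP, pow_one]⟩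
      · have hm1 : (((2 * j + 1 : ℤ)) : ZMod 2) = 1 := by
          rw [Int.cast_add, Int.cast_mul, Int.cast_ofNat, show (2 : ZMod 2) = 0 from rfl, zero_mul,
            zero_add, Int.cast_one]
        rw [hm1] at hnorm hcount
        have hN := hnorm (d := 1) fun Q hQ => natDegree_eq_one_of_mem_zero_one_zmod_two hQ
        rw [card_toFinset_normalizedFactors_X_sq_sub_zero_one_zmod_two] at hcount
        exact ⟨hcount, fun P hP => by rw [hN P hP, pow_one]⟩
    · /- `t` odd: `d_K` odd -/
      have h1 : (((2 * k + 1 : ℤ)) : ZMod 2) = 1 := by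
        rw [Int.cast_add, Int.cast_mul, Int.cast_ofNat, show (2 : ZMod 2) = 0 from rfl, zero_mul,
          zero_add, Int.cast_one]
      obtain ⟨i, hi⟩ := Int.even_mul_succ_self k
      rcases Int.even_or_odd' m with ⟨j, rfl | rfl⟩
      · -- `m` even: `X(X − 1)`, `2` splits, `d_K ≡ 1 (mod 8)`, `κ(2) = 1`
        have h0 : (((2 * j : ℤ)) : ZMod 2) = 0 := by
          rw [Int.cast_mul, Int.cast_ofNat, show (2 : ZMod 2) = 0 from rfl, zero_mul]
        rw [h1, h0] at hnorm hcount
        have hN := hnorm (d := 1) fun Q hQ => natDegree_eq_one_of_mem_one_zero hQ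
        rw [card_toFinset_normalizedFactors_X_sq_sub_one_zero] at hcount
        have hD8 : D % 8 = 1 := by
          rw [hD]
          have : (2 * k + 1) ^ 2 + 4 * (2 * j) = 8 * (i + j) + 1 := by linear_combination 4 * hi
          omega
        exact Or.inl ⟨by rw [if_pos hD8], hcount, fun P hP => by rw [hN P hP, pow_one]⟩
      · -- `m` odd: `X² + X + 1`, `2` is inert, `d_K ≡ 5 (mod 8)`, `κ(2) = −1`
        have h1' : (((2 * j + 1 : ℤ)) : ZMod 2) = 1 := by
          rw [Int.cast_add, Int.cast_mul, Int.cast_ofNat, show (2 : ZMod 2) = 0 from rfl, zero_mul,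
            zero_add, Int.cast_one]
        rw [h1, h1'] at hnorm hcount
        have hN := hnorm (d := 2) fun Q hQ => natDegree_eq_two_of_mem_one_one_zmod_two hQ
        rw [card_toFinset_normalizedFactors_X_sq_sub_one_one_zmod_two] at hcount
        have hD8 : D % 8 = 5 := by
          rw [hD]
          have : (2 * k + 1) ^ 2 + 4 * (2 * j + 1) = 8 * (i + j) + 5 := by linear_combination 4 * hi
          omega
        have hD8' : ¬ D % 8 = 1 := by omega
        exact Or.inr (Or.inl ⟨by rw [if_neg hD8', if_pos hD8], hcount, fun P hP => hN P hP⟩)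
  · -- `p` odd
    haveI : NeZero (2 : ZMod p) := ⟨two_ne_zero_zmod hp2⟩
    have hcast : (((t ^ 2 + 4 * m : ℤ)) : ZMod p) = (t : ZMod p) ^ 2 + 4 * (m : ZMod p) := by
      push_cast
      ring
    have hJ : κ p = (legendreSym p D : ℂ) := by
      rw [hoddp p hp hp2, jacobiSym.legendreSym.to_jacobiSym]
    rw [hJ]
    by_cases h0 : ((D : ℤ) : ZMod p) = 0
    · -- ramified: `p ∣ d_K`, one prime of norm `p`, `κ(p) = 0`
      have hs : (0 : ZMod p) ^ 2 = (t : ZMod p) ^ 2 + 4 * (m : ZMod p) := by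
        rw [← hcast, ← hD, h0]; ring
      have hN := hnorm (d := 1) fun Q hQ => natDegree_eq_one_of_mem_of_sq_eq hs hQ
      rw [card_toFinset_normalizedFactors_X_sq_sub_of_eq_zero (hcast ▸ hD ▸ h0)] at hcount
      refine Or.inr (Or.inr ⟨?_, hcount, fun P hP => by rw [hN P hP, pow_one]⟩)
      rw [(legendreSym.eq_zero_iff p D).mpr h0, Int.cast_zero]
    · by_cases hsq : IsSquare ((D : ℤ) : ZMod p)
      · -- split: two primes of norm `p`, `κ(p) = 1`
        obtain ⟨r, hr⟩ := hsq
        have hs : r ^ 2 = (t : ZMod p) ^ 2 + 4 * (m : ZMod p) := by rw [← hcast, ← hD, hr, sq]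
        have hr0 : r ≠ 0 := by rintro rfl; exact h0 (by rw [hr, mul_zero])
        have hN := hnorm (d := 1) fun Q hQ => natDegree_eq_one_of_mem_of_sq_eq hs hQ
        rw [card_toFinset_normalizedFactors_X_sq_sub_of_sq_eq hs hr0] at hcount
        refine Or.inl ⟨?_, hcount, fun P hP => by rw [hN P hP, pow_one]⟩
        rw [(legendreSym.eq_one_iff p h0).mpr ⟨r, hr⟩, Int.cast_one]
      · -- inert: one prime of norm `p²`, `κ(p) = −1`
        have hns : ¬ IsSquare ((t : ZMod p) ^ 2 + 4 * (m : ZMod p)) := by rwa [← hcast, ← hD]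
        have hN := hnorm (d := 2) fun Q hQ => natDegree_eq_two_of_mem_of_not_isSquare hns hQ
        rw [card_toFinset_normalizedFactors_X_sq_sub_of_not_isSquare hns] at hcount
        refine Or.inr (Or.inl ⟨?_, hcount, fun P hP => hN P hP⟩)
        rw [(legendreSym.eq_neg_one_iff p).mpr hsq, Int.cast_neg, Int.cast_one]

end Literature.NumberTheory.QuadraticFields.Quadratic

/-! ### The Rankin–Selberg local factors over `v ∣ p` -/

namespace Literature.NumberTheory.EllipticCurves

open Literature.NumberTheory.QuadraticFields

variable {K : Type*} [Field K] [NumberField K] {N : ℕ}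

/-- `(p^d)^{−s} = (p^{−s})^d` for natural `p`, `d`. [folklore] -/
private theorem natCast_pow_cpow (p d : ℕ) (s : ℂ) :
    (((p ^ d : ℕ) : ℂ)) ^ s = (((p : ℕ) : ℂ) ^ s) ^ d := by
  induction d with
  | zero => rw [pow_zero, pow_zero, Nat.cast_one, Complex.one_cpow]
  | succ d ih => rw [pow_succ, Nat.cast_mul, Complex.natCast_mul_natCast_cpow, ih, pow_succ]

/-- **The Rankin–Selberg local factor at a place of residue degree `d` over `p`**: if
`N(v) = p^d` (`p` prime, `d ≥ 1`) then, with `w = φ(ϖ_v)` extended by zero, `X = p^{−s}`,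
`e = p·𝟙_{p ∤ N}`: `F_v(s) = 1 − (α^d + β^d) w X^d + e^d w² X^{2d}`
(`frobTracePow (a_p) e d = α^d + β^d`). [cite: Nekovar1995, (0.5) p. 611 and §3.4] -/
theorem rankinSelbergLocalFactorInvHecke_of_absNorm_eq_pow (f : CuspForm (Gamma0 N) 2)
    (φ : HeckeCharacter K) {v : HeightOneSpectrum (𝓞 K)} {p d : ℕ} (hp : p.Prime) (hd : d ≠ 0)
    (hv : absNorm v.asIdeal = p ^ d) (s : ℂ) :
    rankinSelbergLocalFactorInvHecke f φ v s =
      1 - frobTracePow (cuspCoeff f p) (if p ∣ N then 0 else (p : ℂ)) d * heckeValueExtZero φ v *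
          ((p : ℂ) ^ (-s)) ^ d +
        (if p ∣ N then 0 else (p : ℂ)) ^ d * heckeValueExtZero φ v ^ 2 *
          (((p : ℂ) ^ (-s)) ^ d) ^ 2 := by
  have hmin : (p ^ d).minFac = p := by rw [Nat.pow_minFac hd, hp.minFac_eq]
  have hfac : (p ^ d).factorization p = d := by
    rw [Nat.factorization_pow, Finsupp.smul_apply, hp.factorization_self, smul_eq_mul, mul_one]
  have h2s : (((p ^ d : ℕ) : ℂ)) ^ (-2 * s) = ((((p : ℕ) : ℂ) ^ (-s)) ^ d) ^ 2 := by
    rw [show (-2 * s : ℂ) = ((2 : ℕ) : ℂ) * (-s) by push_cast; ring, Complex.cpow_nat_mul,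
      natCast_pow_cpow]
  rw [rankinSelbergLocalFactorInvHecke_eq_one_sub, hv, hmin, hfac, natCast_pow_cpow, h2s]
  ring

/-- **Local Artin formalism for `f` over a quadratic field.** Let `[K : ℚ] = 2`, `κ` a Dirichlet
character with the Kronecker values of `K`, `p` a prime, `f ∈ S₂(Γ₀(N))`, `φ` ANY Hecke character
of `K` and `w ∈ ℂ` such that `φ(ϖ_v)` (extended by zero) equals `w^{f_v}` at every place `v ∣ p`
(`N(v) = p^{f_v}`). Then
`∏_{v ∣ p} F_v(s)⁻¹ = (1 − a_p w p^{−s} + e w² p^{−2s})⁻¹ · (1 − a_p (wκ(p)) p^{−s} + e (wκ(p))² p^{−2s})⁻¹`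
with `e = p·𝟙_{p ∤ N}`: split (`κ(p) = 1`, two places of degree `1`) — the square
(`split_localFactor_sq`); inert (`κ(p) = −1`, one place of degree `2`, `α² + β² = a_p² − 2e`,
`N(v)^{−s} = (p^{−s})²`) — `inert_localFactor_mul`; ramified (`κ(p) = 0`, one place of degree `1`)
— the second factor is `1`. With `w = θ(p)` this is the prime-by-prime content of Gross 2004 §3/§13,
`L(s, f_K ⊗ θ∘N) = L(f ⊗ θ, s) L(f ⊗ θκ, s)`; `w = 0` covers the primes dividing the conductor.
[cite: Gross2004, §3 (p. 40) and §13 (p. 49)] [cite: NeukirchANT1999, Ch. VII (10.4) (iv)] -/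
theorem finprod_rankinSelbergLocalFactorInv_eq_of_heckeValue (h2 : finrank ℚ K = 2) {M : ℕ}
    (κ : DirichletCharacter ℂ M)
    (hoddp : ∀ p : ℕ, p.Prime → p ≠ 2 → κ p = (J(NumberField.discr K | p) : ℂ))
    (htwo : κ 2 = if NumberField.discr K % 8 = 1 then 1
      else if NumberField.discr K % 8 = 5 then -1 else 0)
    (f : CuspForm (Gamma0 N) 2) (φ : HeckeCharacter K) {p : ℕ} (hp : p.Prime) (w s : ℂ)
    (hval : ∀ v : HeightOneSpectrum (𝓞 K), v.asIdeal ∈ primesOver (span {(p : ℤ)}) (𝓞 K) →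
      heckeValueExtZero φ v = w ^ (absNorm v.asIdeal).factorization p) :
    ∏ᶠ v ∈ HeightOneSpectrum.asIdeal ⁻¹' primesOver (span {(p : ℤ)}) (𝓞 K),
        (rankinSelbergLocalFactorInvHecke f φ v s)⁻¹ =
      (1 - w * cuspCoeff f p * (p : ℂ) ^ (-s) +
          (if p ∣ N then 0 else (p : ℂ)) * w ^ 2 * ((p : ℂ) ^ (-s)) ^ 2)⁻¹ *
        (1 - w * κ p * cuspCoeff f p * (p : ℂ) ^ (-s) +
          (if p ∣ N then 0 else (p : ℂ)) * (w * κ p) ^ 2 * ((p : ℂ) ^ (-s)) ^ 2)⁻¹ := by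
  set S := HeightOneSpectrum.asIdeal ⁻¹' primesOver (span {(p : ℤ)}) (𝓞 K) with hS
  set a : ℂ := cuspCoeff f p with ha
  set e : ℂ := (if p ∣ N then 0 else (p : ℂ)) with he
  set X : ℂ := (p : ℂ) ^ (-s) with hX
  have hSn : S.ncard = (primesOver (span {(p : ℤ)}) (𝓞 K)).ncard := ncard_preimage_primesOver hp
  -- the local factor at a place of degree `d` over `p`, given the Hecke value `w^d`
  have hF : ∀ {d : ℕ}, d ≠ 0 → ∀ v ∈ S, absNorm v.asIdeal = p ^ d →
      (rankinSelbergLocalFactorInvHecke f φ v s)⁻¹ =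
        (1 - frobTracePow a e d * w ^ d * X ^ d + e ^ d * (w ^ d) ^ 2 * (X ^ d) ^ 2)⁻¹ := by
    intro d hd v hv hvd
    have hw : heckeValueExtZero φ v = w ^ d := by
      rw [hval v hv, hvd, Nat.factorization_pow, Finsupp.smul_apply, hp.factorization_self,
        smul_eq_mul, mul_one]
    rw [rankinSelbergLocalFactorInvHecke_of_absNorm_eq_pow f φ hp hd hvd s, hw]
  rcases Quadratic.primesOver_trichotomy_of_kronecker h2 κ hoddp htwo hp with
    ⟨hκ, hn, hN⟩ | ⟨hκ, hn, hN⟩ | ⟨hκ, hn, hN⟩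
  · -- split: two places of degree `1`, `κ(p) = 1`
    rw [hn] at hSn
    rw [Quadratic.finprod_mem_eq_of_ncard_eq_two hSn fun v hv =>
        hF one_ne_zero v hv (by rw [pow_one]; exact hN _ hv), frobTracePow_one, hκ]
    congr 1 <;> exact congrArg Inv.inv (by ring)
  · -- inert: one place of degree `2`, `κ(p) = −1`
    rw [hn] at hSn
    rw [Quadratic.finprod_mem_eq_of_ncard_eq_one hSn fun v hv => hF two_ne_zero v hv (hN _ hv),
      frobTracePow_two, hκ, ← mul_inv]
    exact congrArg Inv.inv (by ring)
  · -- ramified: one place of degree `1`, `κ(p) = 0`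
    rw [hn] at hSn
    rw [Quadratic.finprod_mem_eq_of_ncard_eq_one hSn fun v hv =>
        hF one_ne_zero v hv (by rw [pow_one]; exact hN _ hv), frobTracePow_one, hκ,
      show (1 - w * 0 * a * X + e * (w * 0) ^ 2 * X ^ 2 : ℂ) = 1 by ring, inv_one, mul_one]
    exact congrArg Inv.inv (by ring)

/-! ### Consequence: the global identity from the Hecke values -/

/-- The product character `DirichletCharacter.mul ψ χ` (modulus `lcm`) takes the value `ψ(n) χ(n)`
at every natural number `n`. [folklore] -/
private theorem dirichletMul_apply_natCast {m q : ℕ} [NeZero m] [NeZero q]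
    (ψ : DirichletCharacter ℂ m) (χ : DirichletCharacter ℂ q) (n : ℕ) :
    DirichletCharacter.mul ψ χ (n : ZMod (Nat.lcm m q)) = ψ n * χ n := by
  haveI : NeZero (Nat.lcm m q) := ⟨Nat.lcm_ne_zero (NeZero.ne m) (NeZero.ne q)⟩
  rw [DirichletCharacter.mul, MulChar.coeToFun_mul, Pi.mul_apply]
  by_cases hu : IsUnit (n : ZMod (Nat.lcm m q))
  · obtain ⟨u, hu⟩ := hu
    rw [← hu, DirichletCharacter.changeLevel_eq_cast_of_dvd,
      DirichletCharacter.changeLevel_eq_cast_of_dvd, hu, ZMod.cast_natCast (Nat.dvd_lcm_left m q),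
      ZMod.cast_natCast (Nat.dvd_lcm_right m q)]
  · -- `gcd(n, lcm) ≠ 1`: both sides vanish
    rw [MulChar.map_nonunit _ hu, MulChar.map_nonunit _ hu, zero_mul]
    have hcop : ¬ n.Coprime (Nat.lcm m q) := fun h =>
      hu ((ZMod.isUnit_iff_coprime n (Nat.lcm m q)).mpr h)
    by_cases hm : n.Coprime m
    · have hq : ¬ n.Coprime q := fun h =>
        hcop ((Nat.Coprime.mul_right hm h).coprime_dvd_right (Nat.lcm_dvd_mul m q))
      rw [MulChar.map_nonunit χ (mt (ZMod.isUnit_iff_coprime n q).mp hq), mul_zero]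
    · rw [MulChar.map_nonunit ψ (mt (ZMod.isUnit_iff_coprime n m).mp hm), zero_mul]

/-- **Artin formalism for `f` over a quadratic field from the Hecke values.** Let `[K : ℚ] = 2`,
`κ` a Dirichlet character with the Kronecker values of `K`, `f ∈ S₂(Γ₀(N))` a normalised
eigenform (`IsNewform0`), `θ` a Dirichlet character mod `m`, and `φ` a finite-order Hecke character
of `K` with `φ(ϖ_v) = θ(p)^{f_v}` (extended by zero) at every place `v ∣ p`, every prime `p`. Then
for `re s > 2`: `rankinSelbergEulerProductHecke f φ s = L(f ⊗ θ, s) · L(f ⊗ θκ, s)`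
(`twistedLSeries`, `θκ = DirichletCharacter.mul θ κ`). For `φ = ψ_θ ∘ N_{K/ℚ}` this is the
conclusion of `rankinSelbergEulerProductHecke_baseChangeDirichlet_eq`.
[cite: Gross2004, §3 (p. 40) and §13 (p. 49)] [cite: NeukirchANT1999, Ch. VII (10.4) (iv)] -/
theorem rankinSelbergEulerProductHecke_eq_mul_twist_of_heckeValue (h2 : finrank ℚ K = 2) {M : ℕ}
    [NeZero M] (κ : DirichletCharacter ℂ M)
    (hoddp : ∀ p : ℕ, p.Prime → p ≠ 2 → κ p = (J(NumberField.discr K | p) : ℂ))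
    (htwo : κ 2 = if NumberField.discr K % 8 = 1 then 1
      else if NumberField.discr K % 8 = 5 then -1 else 0)
    [NeZero N] {f : CuspForm (Gamma0 N) 2} (hf : IsNewform0 f) {φ : HeckeCharacter K}
    (hφ : φ.IsFiniteOrder) {m : ℕ} [NeZero m] (θ : DirichletCharacter ℂ m) {s : ℂ} (hs : 2 < s.re)
    (hval : ∀ p : ℕ, p.Prime → ∀ v : HeightOneSpectrum (𝓞 K),
      v.asIdeal ∈ primesOver (span {(p : ℤ)}) (𝓞 K) →
        heckeValueExtZero φ v = θ p ^ (absNorm v.asIdeal).factorization p) :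
    rankinSelbergEulerProductHecke f φ s =
      twistedLSeries f θ s * twistedLSeries f (DirichletCharacter.mul θ κ) s := by
  refine rankinSelbergEulerProductHecke_eq_mul_of_local hf hφ θ (DirichletCharacter.mul θ κ) hs
    fun p hp => ?_
  rw [finprod_rankinSelbergLocalFactorInv_eq_of_heckeValue h2 κ hoddp htwo f φ hp (θ p) s (hval p hp),
    dirichletMul_apply_natCast]

end Literature.NumberTheory.EllipticCurves

end
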